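import Summits.QuantumFields.YangMills.Theorems.BalabanLadderIROddTorusLargeFieldRaritySharp
import Summits.QuantumFields.YangMills.Theorems.EquipartitionCriticalityFreeEnergyLogCoefficient
import HarnessLib

/-!
# Crux `IR` (stmt-QuantumFields-19354) — supplier `largefield-rarity-uniform` (ideator ym-ir-idea-5 g6, lens: chessboard ∕ RP)

**β-UNIFORM large-field rarity at the Gaussian threshold on the odd four-tori, beyond a volume `S₁(β)`** — an ASSEMBLY of
three PROVED tree theorems, no `sorry`:

* (T1) the hereditary Peierls–chessboard estimate on the odd torus, sharp rate
  (`OddTorusChessboard.measureReal_forall_le_cellAction_le_pow_sharp`, Fröhlich–Israel–Lieb–Simon Thm. 4.1 on `(ℤ/(2S+1))⁴`):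
  `μ_{L,β}{∀ i ∈ F, T ≤ ∑_{q ∈ P_i} φ_q} ≤ (exp(−λT/m + n Δ_L(λ)/(m L⁴)))^{#F}`, `Δ_L(λ) = log Z_L(β−λ) − log Z_L(β)`, `m = 6`;
* (T2) Chatterjee's leading term of the free energy for every compact simple `G` and faithful unitary lattice representation
  (`Summit.QuantumFields.YangMills.Theorems.freeEnergyLogCoefficient_proof`, crux `FreeEnergyLogCoefficient` of route
  `EquipartitionCriticality`, CLOSED): `f_r(β) + (3D/2) log β → K_r`;
* (T3) existence of the torus free-energy density (`exists_hasFreeEnergyDensity_holds`): `L⁻⁴ log Z_L(β) → f_r(β)`.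

(T2) gives the **pressure-doubling bound** `f_r(β/2) − f_r(β) ≤ (3D/2) log 2 + 1` for `β ≥ β₁(r)` (§1); (T3) transfers it to
`Δ_{2S+1}(β/2)/(2S+1)⁴ ≤ (3D/2) log 2 + 2` for `S ≥ S₁(β)` (§2); inserted in (T1) with `λ = β/2` the base becomes
`exp(−βT/(2m) + n·M/m)` with `M` INDEPENDENT OF `β` AND OF THE VOLUME (§3, `cellRarity_uniform`).  At the Gaussian threshold
`T = A/(2β)` per plaquette this is `exp(−(A/4 − M)/m)` — β-free — whereas the tree's volume-free forms
(`measureReal_forall_le_cellAction_le_pow_rep(_sharp)`, `WeakCouplingRates.su2_measureReal_plaqCost_ge_le_odd`) carry `K₀ + D₁ log β`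
from the crude bounds `log Z_L ≤ 0`, `log Z_L ≥ −L⁴(48 − 4 log C₁ + 2D log β)` and are void at `T ∼ 1/β` as `β → ∞`.

§4 is the corollary in the currency of line 14's stub `SmallFieldPolymerCoder.stub_largeFieldRarity`
(`Cruxes/IR/Lines/smallfield_polymer_coder.lean`; `plaqCost r.ρ U p` there is `plaquetteCost r.ρ U p` here, by `rfl`):
`largeFieldRarityFrom_holds : LargeFieldRarityFrom` — `∀ G r, ∃ A₀, ∀ A > A₀, ∃ c > 0, β₃, S₁, ∀ β ≥ β₃, ∀ S ≥ S₁ β, ∀ Q,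
μ{∀ p ∈ Q, A/(2β) < φ_p} ≤ exp(−c·A·#Q)`.  Two honest deltas w.r.t. the stub AS TYPED (`LargeFieldRarity`: `∀ A > 0`, `∀ S`):
(i) `A > A₀(G,r)` (`A₀ = 4M`; optimising `λ = θβ` gives `A₀ = 3·dim G`; for `A` below the mean plaquette energy `∼ D/4` the event is
not a large-field event and the chessboard rate `p_constr − p` needs a CONSTRAINED weak-coupling free-energy asymptotic, not in print);
(ii) `S ≥ S₁(β)` (the thermodynamic limit (T3) is used at each `β`; an explicit `S₁(β) ≍ log β` follows from the elementary sandwich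
axial-gauge floor ∕ plaquette-capping ceiling — not done here).  Both deltas are harmless for the consumers on this crux: the Peierls sums of
line 14 (M-b) choose `A` large, and `GapInUnits` quantifies `S ≥ S₁ β`.

HONEST FRAMING: a finite-torus large-field RARITY engine (format-level, UV-side); nothing here is a statement about decoupling,
small-field mixing, `BalabanLadder.IR`, a lattice mass gap, or the Clay problem; R4 closes only the conditional 𝕋⁴ rung `BalabanLadder.UV`.
-/

set_option autoImplicit false

noncomputable section

open MeasureTheory Filter Topology Finset
open Literature.MathematicalPhysics.QuantumFieldTheory Literature.MathematicalPhysics.QuantumLattice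
open Summit.QuantumFields.YangMills.Theorems.OddTorusChessboard

namespace Summit.QuantumFields.YangMills.Cruxes.IR.LargeFieldRarityUniform

/-! ## §1 Pressure doubling at weak coupling: `f(β/2) − f(β)` is eventually bounded -/

/-- If `f(β) + D log β → K` then eventually `f(β/2) − f(β) ≤ D log 2 + 1` (pure real analysis). -/
theorem eventually_half_sub_le {f : ℝ → ℝ} {D K : ℝ}
    (h : Tendsto (fun β : ℝ => f β + D * Real.log β) atTop (𝓝 K)) :
    ∀ᶠ β : ℝ in atTop, f (β / 2) - f β ≤ D * Real.log 2 + 1 := by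
  have h2 : Tendsto (fun β : ℝ => β / 2) atTop atTop := tendsto_id.atTop_div_const (by norm_num)
  have h' : Tendsto (fun β : ℝ => f (β / 2) + D * Real.log (β / 2)) atTop (𝓝 K) := h.comp h2
  have hsub : Tendsto (fun β : ℝ => (f (β / 2) + D * Real.log (β / 2)) - (f β + D * Real.log β))
      atTop (𝓝 (K - K)) := h'.sub h
  rw [sub_self] at hsub
  have hev : ∀ᶠ β : ℝ in atTop, (f (β / 2) + D * Real.log (β / 2)) - (f β + D * Real.log β) ∈ Set.Iic (1 : ℝ) :=
    hsub.eventually (Iic_mem_nhds zero_lt_one)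
  filter_upwards [hev, eventually_gt_atTop (0 : ℝ)] with β hβ hβ0
  have hβ' := Set.mem_Iic.1 hβ
  have hlog : Real.log (β / 2) = Real.log β - Real.log 2 := Real.log_div hβ0.ne' (by norm_num)
  rw [hlog] at hβ'
  linarith

variable {G : Type} [Group G] [TopologicalSpace G] [IsTopologicalGroup G] [CompactSpace G]

/-- **Pressure doubling for a compact simple `G` with a faithful unitary lattice representation** (from (T2)):
`∃ M β₁ ≥ 1, ∀ β ≥ β₁, f_r(β/2) − f_r(β) ≤ M` (`M = (3D/2) log 2 + 1`). -/
theorem exists_freeEnergyDensity_half_sub_le (hG : IsCompactSimpleLieGroup G) (r : LatticeRep G) :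
    letI : MeasurableSpace G := borel G
    haveI : BorelSpace G := ⟨rfl⟩
    ∃ M β₁ : ℝ, 1 ≤ β₁ ∧ ∀ β : ℝ, β₁ ≤ β →
      freeEnergyDensity 4 r.ρ (β / 2) - freeEnergyDensity 4 r.ρ β ≤ M := by
  letI : MeasurableSpace G := borel G
  haveI : BorelSpace G := ⟨rfl⟩
  obtain ⟨K, hK⟩ := Summit.QuantumFields.YangMills.Theorems.freeEnergyLogCoefficient_proof G hG r
  have hev := eventually_half_sub_le hK
  obtain ⟨β₁, hβ₁⟩ := Filter.eventually_atTop.1 (hev.and (eventually_ge_atTop (1 : ℝ)))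
  exact ⟨_, β₁, (hβ₁ β₁ le_rfl).2, fun β hβ => (hβ₁ β hβ).1⟩

/-! ## §2 Transfer to the finite odd tori (from (T3)) -/

section Volume

variable [MeasurableSpace G] [BorelSpace G]

/-- If `f(β/2) − f(β) ≤ M` then `Δ_{L+1}(β/2)/(L+1)⁴ ≤ M + 1` for all large `L` (thermodynamic limit at `β` and `β/2`). -/
theorem eventually_torusDelta_le [SecondCountableTopology G] {N : ℕ} (ρ : G →* Matrix (Fin N) (Fin N) ℂ)
    (hρ : Continuous ρ) (β M : ℝ) (hM : freeEnergyDensity 4 ρ (β / 2) - freeEnergyDensity 4 ρ β ≤ M) :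
    ∀ᶠ L : ℕ in atTop, (torusLogPartition 4 ρ (β / 2) (L + 1) - torusLogPartition 4 ρ β (L + 1)) /
        (((L + 1 : ℕ) : ℝ) ^ 4) ≤ M + 1 := by
  have h1 : Tendsto (fun L : ℕ => (((L + 1 : ℕ) : ℝ) ^ 4)⁻¹ * torusLogPartition 4 ρ β (L + 1)) atTop
      (𝓝 (freeEnergyDensity 4 ρ β)) :=
    hasFreeEnergyDensity_freeEnergyDensity ρ (exists_hasFreeEnergyDensity_holds (d := 4) ρ hρ β)
  have h2 : Tendsto (fun L : ℕ => (((L + 1 : ℕ) : ℝ) ^ 4)⁻¹ * torusLogPartition 4 ρ (β / 2) (L + 1)) atTop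
      (𝓝 (freeEnergyDensity 4 ρ (β / 2))) :=
    hasFreeEnergyDensity_freeEnergyDensity ρ (exists_hasFreeEnergyDensity_holds (d := 4) ρ hρ (β / 2))
  have hsub := h2.sub h1
  have hlt : freeEnergyDensity 4 ρ (β / 2) - freeEnergyDensity 4 ρ β < M + 1 := by linarith
  have hev : ∀ᶠ L : ℕ in atTop, ((((L + 1 : ℕ) : ℝ) ^ 4)⁻¹ * torusLogPartition 4 ρ (β / 2) (L + 1) -
      (((L + 1 : ℕ) : ℝ) ^ 4)⁻¹ * torusLogPartition 4 ρ β (L + 1)) ∈ Set.Iic (M + 1) :=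
    hsub.eventually (Iic_mem_nhds hlt)
  filter_upwards [hev] with L hL
  have hL' := Set.mem_Iic.1 hL
  rw [div_eq_inv_mul, mul_sub]
  exact hL'

/-! ## §3 β-uniform hereditary large-field rarity on the odd tori (from (T1)) -/

/-- **β-UNIFORM HEREDITARY LARGE-FIELD RARITY** (hypothesis form: any pressure-doubling bound `M` on `[β₁, ∞)`, `β₁ ≥ 1`).
There is `S₁ : ℝ → ℕ` such that for `β ≥ β₁`, `S ≥ S₁ β`, every family of pairwise disjoint plaquette cells `P_i` (`i ∈ F`) of the torus
`(ℤ/(2S+1))⁴` with at most `n` plaquettes each and every threshold `T`: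
`μ_{2S+1,β}{∀ i ∈ F, T ≤ ∑_{q ∈ P_i} φ_q} ≤ (exp(−βT/(2m) + n(M+1)/m))^{#F}`, `m = #Orient 4 = 6` — the base is free of `β` and `S`. -/
theorem cellRarity_uniform_of_pressureDoubling (r : LatticeRep G) {M β₁ : ℝ} (hβ₁ : 1 ≤ β₁)
    (hM : ∀ β : ℝ, β₁ ≤ β → freeEnergyDensity 4 r.ρ (β / 2) - freeEnergyDensity 4 r.ρ β ≤ M) :
    ∃ S₁ : ℝ → ℕ, ∀ β : ℝ, β₁ ≤ β → ∀ S : ℕ, S₁ β ≤ S →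
      ∀ {ι : Type} (F : Finset ι) (P : ι → Finset (Plaquette 4 (2 * S + 1))),
        (∀ i ∈ F, ∀ j ∈ F, i ≠ j → Disjoint (P i) (P j)) → ∀ (n : ℕ), (∀ i ∈ F, #(P i) ≤ n) → ∀ T : ℝ,
          (wilsonMeasure (d := 4) (L := 2 * S + 1) r.ρ β).real
              {U | ∀ i ∈ F, T ≤ ∑ q ∈ P i, plaquetteCost r.ρ U q} ≤
            (Real.exp (-(β / 2 * T) / Fintype.card (Orient 4) +
              n * (M + 1) / Fintype.card (Orient 4))) ^ #F := by
  classical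
  have hρc : Continuous r.ρ := r.continuous
  haveI : SecondCountableTopology G :=
    (hρc.isClosedEmbedding r.injective).isEmbedding.secondCountableTopology
  -- volume threshold at each `β`
  have key : ∀ β : ℝ, ∃ L₀ : ℕ, β₁ ≤ β → ∀ L : ℕ, L₀ ≤ L →
      (torusLogPartition 4 r.ρ (β / 2) (L + 1) - torusLogPartition 4 r.ρ β (L + 1)) /
        (((L + 1 : ℕ) : ℝ) ^ 4) ≤ M + 1 := by
    intro β
    by_cases hβ : β₁ ≤ β
    · obtain ⟨L₀, hL₀⟩ := Filter.eventually_atTop.1 (eventually_torusDelta_le r.ρ hρc β M (hM β hβ))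
      exact ⟨L₀, fun _ L hL => hL₀ L hL⟩
    · exact ⟨0, fun h => absurd h hβ⟩
  choose L₀ hL₀ using key
  refine ⟨fun β => max 1 (L₀ β), fun β hβ S hS ι F P hdisj n hn T => ?_⟩
  have hS1 : 1 ≤ S := le_trans (le_max_left _ _) hS
  have hSL : L₀ β ≤ 2 * S := le_trans (le_trans (le_max_right _ _) hS) (by omega)
  have hOdd : Odd (2 * S + 1) := ⟨S, by ring⟩
  have h3 : 3 ≤ 2 * S + 1 := by omega
  have hβ0 : 0 ≤ β := by linarith
  have hlam : (0 : ℝ) ≤ β / 2 := by positivity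
  have hlamβ : β / 2 ≤ β := by linarith
  have hm : 0 < Fintype.card (Orient 4) := Fintype.card_pos_iff.2 ⟨⟨((0 : Fin 4), (1 : Fin 4)), by decide⟩⟩
  have hm0 : (0 : ℝ) < Fintype.card (Orient 4) := by exact_mod_cast hm
  have h := measureReal_forall_le_cellAction_le_pow_sharp (d := 4) (L := 2 * S + 1) r.ρ hOdd h3 hρc hlam hlamβ
    F P hdisj hn T hm
  refine h.trans (pow_le_pow_left₀ (by positivity) ?_ _)
  refine Real.exp_le_exp.2 (add_le_add le_rfl ?_)
  have hΔ := hL₀ β hβ (2 * S) hSL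
  rw [sub_half] at h ⊢
  have hn0 : (0 : ℝ) ≤ n := Nat.cast_nonneg _
  have hmul : (n : ℝ) * ((torusLogPartition 4 r.ρ (β / 2) (2 * S + 1) - torusLogPartition 4 r.ρ β (2 * S + 1)) /
      (((2 * S + 1 : ℕ) : ℝ) ^ 4)) ≤ n * (M + 1) := mul_le_mul_of_nonneg_left hΔ hn0
  exact div_le_div_of_nonneg_right hmul hm0.le

/-! ## §4 The corollary in the currency of line 14's `LargeFieldRarity` (singleton cells, threshold `A/(2β)`) -/

/-- **β-uniform single-plaquette-set rarity** (hypothesis form): with a pressure-doubling bound `M` on `[β₁, ∞)`, `β₁ ≥ 1`, for every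
`A > 4(M+1)` there are `c > 0` and `S₁` with `μ_{2S+1,β}{∀ p ∈ Q, A/(2β) < φ_p} ≤ exp(−c·A·#Q)` for all `β ≥ β₁`, `S ≥ S₁ β`, all `Q`. -/
theorem setRarity_uniform_of_pressureDoubling (r : LatticeRep G) {M β₁ : ℝ} (hβ₁ : 1 ≤ β₁)
    (hM : ∀ β : ℝ, β₁ ≤ β → freeEnergyDensity 4 r.ρ (β / 2) - freeEnergyDensity 4 r.ρ β ≤ M) :
    ∀ A : ℝ, max (4 * (M + 1)) 0 < A → ∃ (c : ℝ) (S₁ : ℝ → ℕ), 0 < c ∧ ∀ β : ℝ, β₁ ≤ β →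
      ∀ S : ℕ, S₁ β ≤ S → ∀ Q : Finset (Plaquette 4 (2 * S + 1)),
        (wilsonMeasure (d := 4) (L := 2 * S + 1) r.ρ β).real
            {U | ∀ p ∈ Q, A / (2 * β) < plaquetteCost r.ρ U p} ≤
          Real.exp (-(c * A * #Q)) := by
  classical
  intro A hA
  have hA0 : 0 < A := lt_of_le_of_lt (le_max_right _ _) hA
  have hA4 : 4 * (M + 1) < A := lt_of_le_of_lt (le_max_left _ _) hA
  obtain ⟨S₁, hS₁⟩ := cellRarity_uniform_of_pressureDoubling r hβ₁ hM
  set m : ℝ := (Fintype.card (Orient 4) : ℝ) with hmdef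
  have hm : 0 < Fintype.card (Orient 4) := Fintype.card_pos_iff.2 ⟨⟨((0 : Fin 4), (1 : Fin 4)), by decide⟩⟩
  have hm0 : (0 : ℝ) < m := by rw [hmdef]; exact_mod_cast hm
  -- the β-free rate per plaquette
  set κ : ℝ := (A / 4 - (M + 1)) / m with hκ
  have hκ0 : 0 < κ := by
    rw [hκ]; exact div_pos (by linarith) hm0
  refine ⟨κ / A, S₁, div_pos hκ0 hA0, fun β hβ S hS Q => ?_⟩
  have hβ0 : 0 < β := by linarith
  haveI := isProbabilityMeasure_wilsonMeasure (d := 4) (L := 2 * S + 1) r.ρ r.continuous β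
  -- singleton cells
  have hdisj : ∀ i ∈ Q, ∀ j ∈ Q, i ≠ j → Disjoint ({i} : Finset (Plaquette 4 (2 * S + 1))) {j} :=
    fun i _ j _ hij => Finset.disjoint_singleton.2 hij
  have hn : ∀ i ∈ Q, #({i} : Finset (Plaquette 4 (2 * S + 1))) ≤ 1 := fun i _ => by simp
  have h := hS₁ β hβ S hS Q (fun p => {p}) hdisj 1 hn (A / (2 * β))
  -- the event is contained in the cell event
  have hsub : {U : GaugeConfig 4 (2 * S + 1) G | ∀ p ∈ Q, A / (2 * β) < plaquetteCost r.ρ U p} ⊆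
      {U | ∀ i ∈ Q, A / (2 * β) ≤ ∑ q ∈ ({i} : Finset (Plaquette 4 (2 * S + 1))), plaquetteCost r.ρ U q} := by
    intro U hU i hi
    rw [Finset.sum_singleton]
    exact (hU i hi).le
  refine (measureReal_mono hsub).trans (h.trans ?_)
  -- compare the bases
  have hbase : Real.exp (-(β / 2 * (A / (2 * β))) / Fintype.card (Orient 4) +
      (1 : ℕ) * (M + 1) / Fintype.card (Orient 4)) = Real.exp (-κ) := by
    congr 1
    rw [hκ, hmdef]
    push_cast
    field_simp
    ring
  rw [hbase, ← Real.exp_nat_mul]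
  refine Real.exp_le_exp.2 (le_of_eq ?_)
  field_simp

/-- **(R♭) `LargeFieldRarityFrom`** — line 14's `LargeFieldRarity` (`Cruxes/IR/Lines/smallfield_polymer_coder.lean`, stub
`stub_largeFieldRarity`) with the two honest deltas `A > A₀(G,r)` and `S ≥ S₁(β)`; `plaqCost r.ρ U p` there is
`plaquetteCost r.ρ U p` here (`rfl`). -/
def LargeFieldRarityFrom : Prop :=
  ∀ (G : Type) [Group G] [TopologicalSpace G] [IsTopologicalGroup G] [CompactSpace G],
    IsCompactSimpleLieGroup G →
    letI : MeasurableSpace G := borel G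
    haveI : BorelSpace G := ⟨rfl⟩
    ∀ (r : LatticeRep G), ∃ A₀ : ℝ, ∀ A : ℝ, A₀ < A → ∃ (c β₃ : ℝ) (S₁ : ℝ → ℕ), 0 < c ∧ ∀ β : ℝ, β₃ ≤ β →
      ∀ (S : ℕ), S₁ β ≤ S → ∀ (Q : Finset (Plaquette 4 (2 * S + 1))),
        wilsonMeasure (d := 4) (L := 2 * S + 1) r.ρ β
            {U | ∀ p ∈ Q, A / (2 * β) < plaquetteCost r.ρ U p} ≤
          ENNReal.ofReal (Real.exp (-(c * A * Q.card)))

/-- **`LargeFieldRarityFrom` HOLDS** — assembly of (T1) chessboard, (T2) Chatterjee's leading term (closed crux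
`FreeEnergyLogCoefficient`), (T3) the thermodynamic limit; no `sorry`. -/
theorem largeFieldRarityFrom_holds : LargeFieldRarityFrom := by
  intro G _ _ _ _ hG
  letI : MeasurableSpace G := borel G
  haveI : BorelSpace G := ⟨rfl⟩
  intro r
  obtain ⟨M, β₁, hβ₁, hM⟩ := exists_freeEnergyDensity_half_sub_le hG r
  refine ⟨max (4 * (M + 1)) 0, fun A hA => ?_⟩
  obtain ⟨c, S₁, hc, h⟩ := setRarity_uniform_of_pressureDoubling r hβ₁ hM A hA
  refine ⟨c, β₁, S₁, hc, fun β hβ S hS Q => ?_⟩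
  haveI := isProbabilityMeasure_wilsonMeasure (d := 4) (L := 2 * S + 1) r.ρ r.continuous β
  rw [← ofReal_measureReal]
  exact ENNReal.ofReal_le_ofReal (h β hβ S hS Q)

end Volume

/-! ## §5 The β-uniform hereditary form for the borel structure (service statement for af-pincer-T (iii_T) ∕ hamming (ii)) -/

/-- **β-uniform hereditary large-field rarity on the odd four-tori** for every compact simple `G` and faithful unitary lattice
representation: `∃ M β₁ S₁, ∀ β ≥ β₁, ∀ S ≥ S₁ β`, disjoint cells with `≤ n` plaquettes, any `T`:
`μ_{2S+1,β}{∀ i ∈ F, T ≤ ∑_{q∈P_i} φ_q} ≤ (exp(−βT/(2m) + n·M/m))^{#F}` — the tree's `measureReal_forall_le_cellAction_le_pow_rep_sharp`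
with `K₀ + D₁ log β` replaced by a constant, at the price `S ≥ S₁(β)`. -/
theorem cellRarity_uniform (hG : IsCompactSimpleLieGroup G) (r : LatticeRep G) :
    letI : MeasurableSpace G := borel G
    haveI : BorelSpace G := ⟨rfl⟩
    ∃ (M β₁ : ℝ) (S₁ : ℝ → ℕ), 1 ≤ β₁ ∧ ∀ β : ℝ, β₁ ≤ β → ∀ S : ℕ, S₁ β ≤ S →
      ∀ {ι : Type} (F : Finset ι) (P : ι → Finset (Plaquette 4 (2 * S + 1))),
        (∀ i ∈ F, ∀ j ∈ F, i ≠ j → Disjoint (P i) (P j)) → ∀ (n : ℕ), (∀ i ∈ F, #(P i) ≤ n) → ∀ T : ℝ,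
          (wilsonMeasure (d := 4) (L := 2 * S + 1) r.ρ β).real
              {U | ∀ i ∈ F, T ≤ ∑ q ∈ P i, plaquetteCost r.ρ U q} ≤
            (Real.exp (-(β / 2 * T) / Fintype.card (Orient 4) +
              n * M / Fintype.card (Orient 4))) ^ #F := by
  letI : MeasurableSpace G := borel G
  haveI : BorelSpace G := ⟨rfl⟩
  obtain ⟨M, β₁, hβ₁, hM⟩ := exists_freeEnergyDensity_half_sub_le hG r
  obtain ⟨S₁, hS₁⟩ := cellRarity_uniform_of_pressureDoubling r hβ₁ hM
  exact ⟨M + 1, β₁, S₁, hβ₁, fun β hβ S hS ι F P hdisj n hn T => hS₁ β hβ S hS F P hdisj n hn T⟩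

end Summit.QuantumFields.YangMills.Cruxes.IR.LargeFieldRarityUniform

end
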